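import Literature.NumberTheory.EllipticCurves.BSDSelmerKimPConverse
import Literature.NumberTheory.EllipticCurves.BSDSelmerPConverseHeegnerMainConjectureProofs
import HarnessLib

/-!
# Kim 2022, Thm. 1.1: the `Λ`-module skeleton of §2, proved

Second sibling proof file (theorems only; no definition, no named fact — D-0014/D-0026) of the
bsd.S25 named fact `Literature.NumberTheory.EllipticCurves.kim_analyticRank_eq_one_of_mordellWeilRank_eq_one`
(C.-H. Kim, *On the soft `p`-converse to a theorem of Gross–Zagier and Kolyvagin*, Math. Ann. 387
(2022) = arXiv:2109.12344, **Cor. 1.4**). The first sibling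
`Literature.NumberTheory.EllipticCurves.BSDSelmerKimPConverse` proves the printed deductions
Cor. 1.4 ⇐ Cor. 1.2 ⇐ Thm. 1.1 and leaves the **core of Thm. 1.1** as one opaque hypothesis
`hcore` (`kim_analyticRank_eq_one_of_mordellWeilRank_eq_one_of_kimCore_of_gzk`: the named fact
from `hcore` and Gross–Zagier–Kolyvagin). This file opens `hcore` along the printed proof of
Thm. 1.1 (§2 of the source, chunks 5–6 of the held text `paper:arxiv-2109.12344`):

> "It is remarkable that the argument itself is quite straightforward and extremely simple: the
> Selmer corank is one ⟹ the `p`-strict Selmer corank is zero ⟹ Kato's zeta element is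
> non-trivial ⟹ the analytic rank is one." (§1)

namely (§2): **Prop. 2.7** "Let `E` be a non-CM elliptic curve over `ℚ` and `p` an odd prime.
Assume that `E[p]` is irreducible and the Iwasawa main conjecture inverting `p` holds
(Assumption 2.5). Then the following statements are equivalent. (1) `z_Kato` is non-zero.
(2) `Sel_0(ℚ_∞, E[p^∞])` [sic; `Sel_0(ℚ, E[p^∞])` in the proof] is finite." with its proof "Write
`f_z, f_0 ∈ Λ` to be the distinguished polynomials such that `(f_z) = char_Λ(H¹_Iw(ℚ, T)/Λ z_Kato^∞)`,
`(f_0) = char_Λ(Sel_0(ℚ_∞, E[p^∞])^∨)`. Then (2.1) [IMC inverting `p`] implies that `𝟙(f_0) = 0`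
if and only if `𝟙(f_z) = 0` where `𝟙` is the trivial character. By using the control theorem
for `Sel_0(ℚ_∞, E[p^∞])` [Kurihara 2002], the finiteness of `Sel_0(ℚ, E[p^∞])` is equivalent to
`z_Kato ≠ 0`."; **Prop. 2.8** "(1) `z_Kato` is non-zero ⟺ (2) `res_p(z_Kato)` is non-zero", proof:
"Consider the exact sequence (2.2) `0 → Sel_0(ℚ, V) → Sel(ℚ, V) → E(ℚ_p) ⊗ ℚ_p`. By Prop. 2.7,
`Sel_0(ℚ, E[p^∞])` is finite, so `Sel_0(ℚ, V) = 0`. Thus […] `res_p(z_Kato)` is non-zero.";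
**Prop. 2.10** ((cork1) and (res) `⟹ Sel_0(ℚ, E[p^∞])` finite); **Cor. 2.3**
(Bertolini–Darmon–Venerucci, from Thm. 2.1: for `p` odd, `p² ∤ N`, `L(E, 1) = 0`:
"(1) `ord_{s=1} L(E, s) = 1` ⟺ (2) `P` has infinite order ⟺ (3) `res_p(z_Kato)` is non-zero");
**Thm. 2.4** (Kato: `L(E, 1) ≠ 0 ⟹ Sel(ℚ, E[p^∞])` finite); and "Theorem 1.1 follows from the
combination of Corollary 2.3, Theorem 2.4, Proposition 2.7, Proposition 2.8, and Proposition 2.10."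

## What is proved

As in the tree's other skeleton files (`KatoDivisibilitySkeletonProofs` for Kato's Thm. 17.4,
`BSDSelmerPConverseHeegnerMainConjectureProofs` for Wan's Thm. 3.17), the arithmetic objects —
Kato's Iwasawa cohomology `S = H¹_Iw(ℚ, T) ∋ κ = z_Kato^∞`, the dual `X = Sel_0(ℚ_∞, E[p^∞])^∨` of
the `p`-strict Selmer group over the cyclotomic tower, `H = H¹(G_{ℚ,Σ}, T) ∋ z = z_Kato` and
`res_p : H → P = H¹(ℚ_p, T)` — do not exist in Mathlib or `Literature/` and are NOT assumed as named
facts: they are abstract `Λ = ℤ_p⟦T⟧`-modules / groups, and the printed inputs about them are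
explicit hypotheses. What the source PROVES about them is proved here:

* `IwasawaAlgebra.exists_span_pow_mul_le_of_span_pow_mul_eq` — Assumption 2.5 as printed (an
  equality of characteristic ideals in `Λ ⊗ ℚ_p`: `p^a · I = p^b · J`) gives the one divisibility
  `p^b · J ⊆ I` that the proof uses.
* `IwasawaAlgebra.lengthAt_primeT_eq_zero_of_span_pow_mul_charIdeal_le` — the module theory of
  the proof of Prop. 2.7: if `X` is finitely generated torsion with `X/TX` finite ("`𝟙(f_0) ≠ 0`",
  Greenberg's Lemma 4.2, tree theorem `order_charGenerator_eq_zero_of_finite_coinvariants`) and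
  `p^n · char_Λ(X) ⊆ char_Λ(N)` for some `n` (equality of characteristic ideals **in `Λ ⊗ ℚ_p`**,
  Assumption 2.5, gives this with the roles of `f_z`, `f_0`; only this divisibility — the one of
  Skinner–Urban–Wan, Remark 2.6 — is used), then `N_𝔭 = 0` at `𝔭 = (T)` ("`𝟙(f_z) ≠ 0`"): a power
  of `p` has `T`-order `0`, so `ℓ_𝔭(N) ≤ ord_T(p^n f_X) = ord_T f_X = 0`
  (`lengthAt_primeT_le_order`, `PowerSeries.order_mul`).
* `IwasawaAlgebra.pow_smul_notMem_TSubmodule_of_finite_coinvariants`,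
  `….pow_smul_mkQ_ne_zero_of_finite_coinvariants`,
  `….pow_smul_specialization_ne_zero_of_finite_coinvariants` — **Prop. 2.7, (2) ⟹ (1)** (the
  direction the proof of Thm. 1.1 uses): for `S` finitely generated torsion-free, `κ ∈ S` nonzero
  with `S/Λκ` torsion (Kato, Astérisque 295, Thm. 12.4 (2): `H¹_Iw(ℚ, T)` is torsion-free with
  `H¹ ⊗ ℚ` free of rank one; `S/Λκ` is torsion because the zeta elements already span a submodule
  of `Λ`-rank one, loc. cit. §17.13), the two hypotheses above give
  `p^m κ ∉ TS` for all `m` (tree theorem `pow_smul_notMem_TSubmodule_of_lengthAt_eq_zero`, Wan's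
  Step 3), i.e. the class of `κ` in `S_Γ = S/TS` is not `ℤ_p`-torsion, and so is its image
  `z = sp(κ mod TS)` under any additive `sp : S_Γ → H` with `ℤ_p`-torsion kernel (the
  specialisation `H¹_Iw(ℚ, T)_Γ ↪ H¹(ℚ, T)`): "`z_Kato ≠ 0`" in `H ⊗ ℚ = H¹(ℚ, V)`.
* `Kim2022.pow_smul_map_ne_zero_of_ker_torsion` — **Prop. 2.8, (1) ⟹ (2)**: if every class of `H`
  with `res_p = 0` is torsion ("`Sel_0(ℚ, V) = 0`"; for `V = V_pE` one has `H¹(ℚ_ℓ, V) = 0` at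
  `ℓ ≠ p`, so `Sel_0(ℚ, V) = ker (res_p : H¹(G_{ℚ,Σ}, V) → H¹(ℚ_p, V))`) and `z` is not torsion,
  then `res_p z` is not torsion ("`res_p(z_Kato) ≠ 0`").
* `Kim2022.analyticRank_eq_one_of_skeleton` — **Thm. 1.1 (core)** for one curve `E/ℚ` and prime `p`
  from the skeleton data: (K) `S, κ` as above and `X` finitely generated torsion (a quotient of
  `Sel_{p^∞}(E/ℚ_∞)^∨`, Kato Thm. 17.4 (1)); (IMC) `p^n char_Λ(X) ⊆ char_Λ(S/Λκ)` (Assumption 2.5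
  with Remark 2.6: Kato + Skinner–Urban + Wan for `p ≥ 5` good ordinary, `E[p]` irreducible); (CTL)
  `Sel_0(ℚ, E[p^∞])` finite `⟹ X/TX` finite (Kurihara's control theorem for the `p`-strict Selmer
  group, as used in the proof of Prop. 2.7, through `(A^Γ)^∨ = (A^∨)_Γ`); (SP) the specialisation
  `sp`; (LOC) `Sel_0(ℚ, E[p^∞])` finite `⟹ Sel_0(ℚ, V) = 0` (proof of Prop. 2.8); (BDV) Cor. 2.3,
  (3) ⟹ (1), under `L(E, 1) = 0`. Here `Sel_0(ℚ, E[p^∞])` IS the tree's object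
  `Sel_{p^∞}(E/ℚ) ⊓ ker (H¹(ℚ, E[p^∞]) → H¹(ℚ_p, E[p^∞]))`
  (`W.selmerGroupPInfty p ⊓ selmerLocalKerPrimaryTorsion W ℚ_[p] p`), and the conclusion IS
  `W.analyticRank = 1`.
* `Kim2022.analyticRank_eq_one_of_selmerCorank_eq_one_of_skeleton` — **Cor. 1.2** (with (res) in
  its `p^∞`-form, as in the first sibling) from the skeleton data, Thm. 2.4 (tree fact
  `kato_finite_of_L_one_ne_zero W p`, which removes `L(E, 1) = 0`) and Gross–Zagier–Kolyvagin
  (tree fact `rank_eq_analyticRank_of_analyticRank_le_one`, the "in particular" clauses).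
* `Kim2022.analyticRank_eq_one_of_mordellWeilRank_eq_one_of_skeleton` — **Cor. 1.4** for one
  `(E, p)` from the skeleton data and Gross–Zagier–Kolyvagin alone: (cork1) from `rk = 1`,
  `#Ш[p^∞] < ∞` by the corank identity (tree theorems
  `WeierstrassCurve.selmerCorank_eq_mordellWeilRank_add_holds`, `zpCorank_eq_zero_of_finite`),
  `Sel_0(ℚ, E[p^∞])` finite by the rank-one strict-Selmer lemma (tree theorem
  `finite_strictSelmer_of_mordellWeilRank_eq_one`, replacing Prop. 2.10), Thm. 2.4 from
  Gross–Zagier–Kolyvagin (tree theorem `kato_finite_of_L_one_ne_zero_of_rank_eq_analyticRank`).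
* `kim_analyticRank_eq_one_of_mordellWeilRank_eq_one_of_skeleton` — the named fact itself from
  skeleton data for every non-CM `E/ℚ` and good ordinary `p > 3` with `E[p]` irreducible (one
  hypothesis `hdata`, spelled out) and Gross–Zagier–Kolyvagin, through the first sibling's
  `kim_analyticRank_eq_one_of_mordellWeilRank_eq_one_of_kimCore_of_gzk`. Composed, this is the
  complete statement of what remains between the tree and
  `kim_analyticRank_eq_one_of_mordellWeilRank_eq_one_holds`: Kato's Euler system for `T_pE`
  (`H¹_Iw`, `z_Kato^∞`, Thm. 12.4), the cyclotomic main conjecture inverting `p` à la Kato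
  (Kato, Skinner–Urban, Wan), Kurihara's control theorem for `Sel_0`, the comparison
  `Sel_0(ℚ, E[p^∞])` finite `⟹ Sel_0(ℚ, V) = 0`, Bertolini–Darmon–Venerucci's Thm. 2.1/Cor. 2.3,
  and bsd.S17 — none of which is asserted here.

What is deliberately NOT here: any definition of `H¹_Iw(ℚ, T)`, `z_Kato`, `Sel(ℚ, V)` or of the
strict Selmer group over `ℚ_∞`, and any new named fact (D-0026); the unused directions
(1) ⟹ (2) of Prop. 2.7, (2) ⟹ (1) of Prop. 2.8 and (1) ⟹ (3) of Cor. 2.3; the hypotheses "non-CM,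
`p > 3` good ordinary, `E[p]` irreducible", which the printed proof uses only to supply (IMC)
(Remark 2.6) and Kato's theorems, and which therefore appear only in the final `∀`-glue.

## References

* [Kim2022] C.-H. Kim, Math. Ann. 387 (2022), 1961–1968 = arXiv:2109.12344: Thm. 1.1, Cor. 1.2,
  Cor. 1.4 (§1); Thm. 2.1, Cor. 2.3, Thm. 2.4, Assumption 2.5, Remark 2.6, Props. 2.7, 2.8, 2.10,
  Remark 2.11 and the concluding paragraph of §2.
* [Kato2004Asterisque] K. Kato, Astérisque 295 (2004): Thm. 12.4 (`H¹_Iw` torsion-free, rank one;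
  `H²` torsion), §13 (zeta elements), Thm. 17.4 (cited by the source as [kato-euler-systems]).
* M. Kurihara, Invent. Math. 149 (2002), 195–224 (control theorem for the `p`-strict Selmer group;
  the source's [kurihara-invent]).
* [SkinnerUrban2014] C. Skinner, E. Urban, Invent. Math. 195 (2014); X. Wan, Forum Math. Sigma 3
  (2015) e18 (Remark 2.6 of the source).
* [BertoliniDarmonVenerucci2022] M. Bertolini, H. Darmon, R. Venerucci, *Heegner points and
  Beilinson–Kato elements: a conjecture of Perrin-Riou*, Adv. Math. 398 (2022) (Thm. 2.1 of the
  source).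
* [GreenbergLNM1716] R. Greenberg, LNM 1716 (1999), Lemma 4.2 (`X/TX` finite `⟺ T ∤ f_X`).
-/

noncomputable section

open scoped Classical

open WeierstrassCurve

universe u v w

namespace Literature.NumberTheory.EllipticCurves

/-! ### Prop. 2.7: the module theory -/

namespace IwasawaAlgebra

variable (p : ℕ) [Fact p.Prime]

/-- **Kim 2022, proof of Prop. 2.7, module-theoretic content.** Let `X` and `N` be finitely
generated torsion `Λ`-modules with `X/TX` finite and `p^n · char_Λ(X) ⊆ char_Λ(N)` for some `n`
(i.e. `f_N ∣ p^n f_X`; this is what the equality `(f_N) = (f_X)` **in `Λ ⊗ ℚ_p`** of Assumption 2.5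
provides, with `N = H¹_Iw(ℚ, T)/Λ z_Kato^∞`, `X = Sel_0(ℚ_∞, E[p^∞])^∨`). Then `N_𝔭 = 0` at the
height-one prime `𝔭 = (T)`, i.e. `T ∤ f_N` ("`𝟙(f_0) ≠ 0 ⟹ 𝟙(f_z) ≠ 0`"): a generator `f_X` of
`char(X)` has `ord_T f_X = 0` (Greenberg, LNM 1716, Lemma 4.2; tree theorem
`order_charGenerator_eq_zero_of_finite_coinvariants`), `p^n f_X ∈ char(N)`, and
`ℓ_𝔭(N) ≤ ord_T(p^n f_X) = ord_T(p^n) + ord_T(f_X) = 0` (`lengthAt_primeT_le_order`; the constant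
`p^n` has nonzero constant term). [cite: Kim2022, Prop. 2.7 (proof) and Assumption 2.5] -/
theorem lengthAt_primeT_eq_zero_of_span_pow_mul_charIdeal_le {X : Type v} {N : Type u}
    [AddCommGroup X] [Module (IwasawaAlgebra p) X] [Module.Finite (IwasawaAlgebra p) X]
    [AddCommGroup N] [Module (IwasawaAlgebra p) N] [Module.Finite (IwasawaAlgebra p) N]
    (hX : Module.IsTorsion (IwasawaAlgebra p) X) (hN : Module.IsTorsion (IwasawaAlgebra p) N)
    (hfin : Finite (coinvariants p X))
    (hle : ∃ n : ℕ, Ideal.span {(p : IwasawaAlgebra p) ^ n} * Module.charIdeal (IwasawaAlgebra p) X ≤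
      Module.charIdeal (IwasawaAlgebra p) N) :
    Module.lengthAt (IwasawaAlgebra p) N (primeT p) = 0 := by
  obtain ⟨n, hle⟩ := hle
  obtain ⟨f, hf⟩ := (charIdeal_isPrincipal_holds p X).principal
  have hf' : Module.charIdeal (IwasawaAlgebra p) X = Ideal.span {f} := hf
  -- `T ∤ f_X`
  have hord : f.order = 0 := order_charGenerator_eq_zero_of_finite_coinvariants p X hX f hf' hfin
  -- `p^n f_X ∈ char(N)`
  have hmem : (p : IwasawaAlgebra p) ^ n * f ∈ Module.charIdeal (IwasawaAlgebra p) N :=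
    hle (Ideal.mul_mem_mul (Ideal.mem_span_singleton_self _)
      (hf' ▸ Ideal.mem_span_singleton_self f))
  -- `ord_T (p^n) = 0`
  have hpn : ((p : IwasawaAlgebra p) ^ n).order = 0 := by
    by_contra h0
    have h := PowerSeries.order_ne_zero_iff_constCoeff_eq_zero.mp h0
    rw [map_pow, map_natCast] at h
    exact pow_ne_zero n (NeZero.ne (p : ℤ_[p])) h
  have h := lengthAt_primeT_le_order N hN _ hmem
  rw [PowerSeries.order_mul, hpn, hord, zero_add] at h
  exact nonpos_iff_eq_zero.mp h

/-- **Assumption 2.5 (IMC inverting `p`) ⟹ the divisibility used.** An equality of ideals of `Λ`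
"in `Λ ⊗ ℚ_p`", i.e. `p^a · I = p^b · J` for some `a, b` (for the principal ideals
`I = char_Λ(H¹_Iw(ℚ, T)/Λ z_Kato^∞) = (f_z)`, `J = char_Λ(Sel_0(ℚ_∞, E[p^∞])^∨) = (f_0)` this is
(2.1): `f_z` and `f_0` agree up to a unit of `Λ[1/p]`), gives `p^b · J ⊆ I` — the only consequence
of (2.1) that the proof of Thm. 1.1 uses (hypothesis `hMC` below, with `J = char(X)`,
`I = char(S/Λκ)`). [cite: Kim2022, Assumption 2.5 and Remark 2.6] -/
theorem exists_span_pow_mul_le_of_span_pow_mul_eq {I J : Ideal (IwasawaAlgebra p)}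
    (h : ∃ a b : ℕ, Ideal.span {(p : IwasawaAlgebra p) ^ a} * I =
      Ideal.span {(p : IwasawaAlgebra p) ^ b} * J) :
    ∃ n : ℕ, Ideal.span {(p : IwasawaAlgebra p) ^ n} * J ≤ I := by
  obtain ⟨a, b, h⟩ := h
  exact ⟨b, h ▸ Ideal.mul_le_left⟩

/-- **Kim 2022, Prop. 2.7, (2) ⟹ (1), `Λ`-module skeleton.** Over `Λ = ℤ_p⟦T⟧` let `S` be finitely
generated and torsion-free and `κ ∈ S` nonzero with `S/Λκ` torsion — `S = H¹_Iw(ℚ, T)`,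
torsion-free with `S ⊗ ℚ` free of rank one (Kato, Astérisque 295, Thm. 12.4 (2)), `κ = z_Kato^∞`
Kato's zeta element over `ℚ_∞`, which spans a submodule of `Λ`-rank one (loc. cit. §17.13), so
that `S/Λκ` is torsion; let `X` be finitely generated torsion —
`X = Sel_0(ℚ_∞, E[p^∞])^∨`; assume `p^n · char_Λ(X) ⊆ char_Λ(S/Λκ)` for some `n` — the Iwasawa
main conjecture inverting `p` (Assumption 2.5, of which only this divisibility, Skinner–Urban–Wan's
(Remark 2.6), is used) — and that `X/TX` is finite — by Kurihara's control theorem for the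
`p`-strict Selmer group this is "(2) `Sel_0(ℚ, E[p^∞])` is finite". Then `p^m κ ∉ TS` for every
`m`: the image of `z_Kato^∞` in `S_Γ = S/TS ↪ H¹(ℚ, T)` is not torsion, "(1) `z_Kato` is non-zero".
Proof: `(S/Λκ)_𝔭 = 0` at `𝔭 = (T)` (`lengthAt_primeT_eq_zero_of_span_pow_mul_charIdeal_le`), then
the tree theorem `pow_smul_notMem_TSubmodule_of_lengthAt_eq_zero`.
[cite: Kim2022, Prop. 2.7 and its proof (Assumption 2.5, Remark 2.6)] -/
theorem pow_smul_notMem_TSubmodule_of_finite_coinvariants {S : Type u} {X : Type v}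
    [AddCommGroup S] [Module (IwasawaAlgebra p) S] [Module.Finite (IwasawaAlgebra p) S]
    [NoZeroSMulDivisors (IwasawaAlgebra p) S]
    [AddCommGroup X] [Module (IwasawaAlgebra p) X] [Module.Finite (IwasawaAlgebra p) X]
    {κ : S} (hκ : κ ≠ 0)
    (hS : Module.IsTorsion (IwasawaAlgebra p) (S ⧸ Submodule.span (IwasawaAlgebra p) {κ}))
    (hX : Module.IsTorsion (IwasawaAlgebra p) X)
    (hMC : ∃ n : ℕ, Ideal.span {(p : IwasawaAlgebra p) ^ n} * Module.charIdeal (IwasawaAlgebra p) X ≤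
      Module.charIdeal (IwasawaAlgebra p) (S ⧸ Submodule.span (IwasawaAlgebra p) {κ}))
    (hfin : Finite (coinvariants p X)) (m : ℕ) :
    ((p : IwasawaAlgebra p) ^ m) • κ ∉ TSubmodule p S :=
  pow_smul_notMem_TSubmodule_of_lengthAt_eq_zero p hκ
    (lengthAt_primeT_eq_zero_of_span_pow_mul_charIdeal_le p hX hS hfin hMC) m

/-- The same conclusion in the `Γ`-coinvariants `S_Γ = S/TS`: `p^m • (κ mod TS) ≠ 0` for every `m`.
[cite: Kim2022, Prop. 2.7 and its proof] -/
theorem pow_smul_mkQ_ne_zero_of_finite_coinvariants {S : Type u} {X : Type v}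
    [AddCommGroup S] [Module (IwasawaAlgebra p) S] [Module.Finite (IwasawaAlgebra p) S]
    [NoZeroSMulDivisors (IwasawaAlgebra p) S]
    [AddCommGroup X] [Module (IwasawaAlgebra p) X] [Module.Finite (IwasawaAlgebra p) X]
    {κ : S} (hκ : κ ≠ 0)
    (hS : Module.IsTorsion (IwasawaAlgebra p) (S ⧸ Submodule.span (IwasawaAlgebra p) {κ}))
    (hX : Module.IsTorsion (IwasawaAlgebra p) X)
    (hMC : ∃ n : ℕ, Ideal.span {(p : IwasawaAlgebra p) ^ n} * Module.charIdeal (IwasawaAlgebra p) X ≤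
      Module.charIdeal (IwasawaAlgebra p) (S ⧸ Submodule.span (IwasawaAlgebra p) {κ}))
    (hfin : Finite (coinvariants p X)) (m : ℕ) :
    p ^ m • (Submodule.Quotient.mk κ : coinvariants p S) ≠ 0 := by
  intro h0
  apply pow_smul_notMem_TSubmodule_of_finite_coinvariants p hκ hS hX hMC hfin m
  rw [← Nat.cast_smul_eq_nsmul (IwasawaAlgebra p), ← Submodule.Quotient.mk_smul,
    Submodule.Quotient.mk_eq_zero, Nat.cast_pow] at h0
  exact h0

/-- **Specialisation** ("`z_Kato` is non-zero" in `H¹(ℚ, V) = H¹(ℚ, T) ⊗ ℚ`): if, in the situation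
of `pow_smul_mkQ_ne_zero_of_finite_coinvariants`, `sp : S/TS → H` is additive with `ℤ_p`-torsion
kernel — the map `H¹_Iw(ℚ, T)_Γ ↪ H¹(ℚ, T)` induced by corestriction to the bottom layer, which
carries `z_Kato^∞ mod T` to (a nonzero rational multiple of) `z_Kato` — then `z := sp (κ mod TS)`
has `p^m • z ≠ 0` for all `m`. [cite: Kim2022, Prop. 2.7 and its proof] -/
theorem pow_smul_specialization_ne_zero_of_finite_coinvariants {S : Type u} {X : Type v}
    {H : Type*}
    [AddCommGroup S] [Module (IwasawaAlgebra p) S] [Module.Finite (IwasawaAlgebra p) S]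
    [NoZeroSMulDivisors (IwasawaAlgebra p) S]
    [AddCommGroup X] [Module (IwasawaAlgebra p) X] [Module.Finite (IwasawaAlgebra p) X]
    [AddCommGroup H]
    {κ : S} (hκ : κ ≠ 0)
    (hS : Module.IsTorsion (IwasawaAlgebra p) (S ⧸ Submodule.span (IwasawaAlgebra p) {κ}))
    (hX : Module.IsTorsion (IwasawaAlgebra p) X)
    (hMC : ∃ n : ℕ, Ideal.span {(p : IwasawaAlgebra p) ^ n} * Module.charIdeal (IwasawaAlgebra p) X ≤
      Module.charIdeal (IwasawaAlgebra p) (S ⧸ Submodule.span (IwasawaAlgebra p) {κ}))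
    (hfin : Finite (coinvariants p X))
    (sp : coinvariants p S →+ H) (hsp : ∀ x, sp x = 0 → ∃ n : ℕ, p ^ n • x = 0) (m : ℕ) :
    p ^ m • sp (Submodule.Quotient.mk κ) ≠ 0 := by
  intro h0
  rw [← map_nsmul] at h0
  obtain ⟨n, hn⟩ := hsp _ h0
  rw [← mul_nsmul', ← pow_add] at hn
  exact pow_smul_mkQ_ne_zero_of_finite_coinvariants p hκ hS hX hMC hfin (n + m) hn

end IwasawaAlgebra

/-! ### Prop. 2.8, Thm. 1.1, Cor. 1.2, Cor. 1.4 along the printed proof -/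

namespace Kim2022

/-- **Kim 2022, Prop. 2.8, (1) ⟹ (2).** Printed proof: "Consider the exact sequence
`0 → Sel_0(ℚ, V) → Sel(ℚ, V) → E(ℚ_p) ⊗ ℚ_p` (2.2). By Proposition 2.7, `Sel_0(ℚ, E[p^∞])` is
finite, so `Sel_0(ℚ, V) = 0`. Thus […] `res_p(z_Kato)` is non-zero." Integral transcription with
`H = H¹(G_{ℚ,Σ}, T)`, `P = H¹(ℚ_p, T)`, `res = res_p`: if every class with `res_p = 0` is
`ℤ_p`-torsion (`Sel_0(ℚ, V) = ker (res_p ⊗ ℚ) = 0`; for `V = V_pE` the groups `H¹(ℚ_ℓ, V)`,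
`ℓ ≠ p`, vanish, so no condition away from `p` is lost) and `z` is not torsion, then `res_p z` is
not torsion: `p^m res_p(z) = 0` would give `res_p(p^m z) = 0`, hence `p^{n+m} z = 0`.
[cite: Kim2022, Prop. 2.8 and its proof] -/
theorem pow_smul_map_ne_zero_of_ker_torsion {H : Type*} {P : Type*} [AddCommGroup H]
    [AddCommGroup P] {p : ℕ} (res : H →+ P) {z : H} (hz : ∀ m : ℕ, p ^ m • z ≠ 0)
    (h0 : ∀ x : H, res x = 0 → ∃ n : ℕ, p ^ n • x = 0) (m : ℕ) : p ^ m • res z ≠ 0 := by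
  intro hm
  rw [← map_nsmul] at hm
  obtain ⟨n, hn⟩ := h0 _ hm
  rw [← mul_nsmul', ← pow_add] at hn
  exact hz (n + m) hn

/-- **(CTL) from Pontryagin duality and the control theorem** (proof of Prop. 2.7: "By using the
control theorem for `Sel_0(ℚ_∞, E[p^∞])` [Kurihara], the finiteness of `Sel_0(ℚ, E[p^∞])` is
equivalent to […]"). Let `A` be a discrete `Γ`-module (`A = Sel_0(ℚ_∞, E[p^∞])`, `ψ = γ - 1`) in
axiomatic Pontryagin duality with the `Λ`-module `X` (`X = A^∨`, tree structure
`IwasawaDual.IsDualPair`), and `θ : B → A^Γ` a homomorphism with finite cokernel — the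
restriction `Sel_0(ℚ, E[p^∞]) → Sel_0(ℚ_∞, E[p^∞])^Γ`, which by Kurihara's control theorem has
finite kernel and cokernel (only the cokernel is used). If `B` is finite then so is `A^Γ`, hence
so is its dual `X/TX` (tree theorem `IsDualPair.finite_coinvariants_iff`, `(A^Γ)^∨ ≅ X_Γ`). This
supplies hypothesis `hctl` of `analyticRank_eq_one_of_skeleton` from the printed form of the
control theorem. [cite: Kim2022, Prop. 2.7 (proof)] -/
theorem finite_coinvariants_of_finite_coker {p : ℕ} [Fact p.Prime]
    {A : Type*} [AddCommGroup A] {ψ : AddMonoid.End A}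
    {X : Type*} [AddCommGroup X] [Module (IwasawaAlgebra p) X]
    {toDual : X →+ (A →+ AddCircle (1 : ℚ))} (hdual : IwasawaDual.IsDualPair p ψ toDual)
    {B : Type*} [AddCommGroup B] (θ : B →+ ↥(IwasawaDual.endInvariants ψ))
    (hcoker : Finite (↥(IwasawaDual.endInvariants ψ) ⧸ θ.range)) (hB : Finite B) :
    Finite (IwasawaAlgebra.coinvariants p X) := by
  refine hdual.finite_coinvariants_iff.mpr ?_
  haveI := hcoker
  haveI : Finite θ.range := Finite.of_surjective θ.rangeRestrict θ.rangeRestrict_surjective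
  exact Finite.of_addSubgroup_quotient θ.range

variable (W : WeierstrassCurve ℚ) [W.IsElliptic] (p : ℕ) [Fact p.Prime]

omit [W.IsElliptic] in
/-- **Kim 2022, Thm. 1.1 — the core, from the `Λ`-module skeleton of §2.** For an elliptic curve
`E/ℚ` (model `W`) and a prime `p`, suppose given, over `Λ = ℤ_p⟦T⟧`:
* (K) `S` finitely generated torsion-free, `κ ∈ S` nonzero with `S/Λκ` torsion, and `X` finitely
  generated torsion — Kato's `H¹_Iw(ℚ, T) ∋ z_Kato^∞` (Astérisque 295, Thm. 12.4 (2), §13, §17.13)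
  and `X = Sel_0(ℚ_∞, E[p^∞])^∨` (torsion, being a quotient of `Sel_{p^∞}(E/ℚ_∞)^∨`: loc. cit.
  Thm. 17.4 (1), `p` good ordinary);
* (IMC) `p^n · char_Λ(X) ⊆ char_Λ(S/Λκ)` for some `n` — Assumption 2.5 (IMC inverting `p`), by
  Remark 2.6 a theorem of Kato, Skinner–Urban and Wan for `p ≥ 5` good ordinary with `E[p]`
  irreducible; only this divisibility is used;
* (CTL) `Sel_0(ℚ, E[p^∞])` finite `⟹ X/TX` finite — Kurihara's control theorem for the `p`-strict
  Selmer group (proof of Prop. 2.7), `Sel_0(ℚ, E[p^∞])` being the tree's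
  `Sel_{p^∞}(E/ℚ) ⊓ ker (res_p)` (`W.selmerGroupPInfty p ⊓ selmerLocalKerPrimaryTorsion W ℚ_[p] p`);
* (SP) `sp : S/TS → H` additive with torsion kernel — `H¹_Iw(ℚ, T)_Γ ↪ H = H¹(G_{ℚ,Σ}, T)`,
  `z := sp(κ mod TS)` standing for `z_Kato`;
* (LOC) `Sel_0(ℚ, E[p^∞])` finite `⟹` every `x ∈ H` with `res x = 0` is torsion — "so
  `Sel_0(ℚ, V) = 0`" (proof of Prop. 2.8), `res : H → P = H¹(ℚ_p, T)` the restriction at `p`;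
* (BDV) if `L(E, 1) = 0` and `res z` is not torsion then `ord_{s=1} L(E, s) = 1` — Cor. 2.3,
  (3) ⟹ (1) (Bertolini–Darmon–Venerucci, Thm. 2.1; its hypotheses "`p` odd, `p² ∤ N`" hold at a
  good prime `p > 3`).
If `L(E, 1) = 0` and `Sel_0(ℚ, E[p^∞])` is finite, then `ord_{s=1} L(E, s) = 1`. This is the
hypothesis `hcore` of `analyticRank_eq_one_of_selmerCorank_eq_one_of_kimCore` at `(E, p)`, proved
from the skeleton: Prop. 2.7 (`pow_smul_specialization_ne_zero_of_finite_coinvariants`), Prop. 2.8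
(`pow_smul_map_ne_zero_of_ker_torsion`), Cor. 2.3.
[cite: Kim2022, Thm. 1.1 and §2 (proof: Cor. 2.3, Props. 2.7, 2.8, Assumption 2.5, Remark 2.6)] -/
theorem analyticRank_eq_one_of_skeleton
    {S : Type u} [AddCommGroup S] [Module (IwasawaAlgebra p) S]
    [Module.Finite (IwasawaAlgebra p) S] [NoZeroSMulDivisors (IwasawaAlgebra p) S]
    {X : Type v} [AddCommGroup X] [Module (IwasawaAlgebra p) X]
    [Module.Finite (IwasawaAlgebra p) X]
    {H : Type w} [AddCommGroup H] {P : Type*} [AddCommGroup P]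
    {κ : S} (hκ : κ ≠ 0)
    (hS : Module.IsTorsion (IwasawaAlgebra p) (S ⧸ Submodule.span (IwasawaAlgebra p) {κ}))
    (hX : Module.IsTorsion (IwasawaAlgebra p) X)
    (hMC : ∃ n : ℕ, Ideal.span {(p : IwasawaAlgebra p) ^ n} * Module.charIdeal (IwasawaAlgebra p) X ≤
      Module.charIdeal (IwasawaAlgebra p) (S ⧸ Submodule.span (IwasawaAlgebra p) {κ}))
    (hctl : Finite ↥(W.selmerGroupPInfty p ⊓ selmerLocalKerPrimaryTorsion W ℚ_[p] p) →
      Finite (IwasawaAlgebra.coinvariants p X))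
    (sp : IwasawaAlgebra.coinvariants p S →+ H) (hsp : ∀ x, sp x = 0 → ∃ n : ℕ, p ^ n • x = 0)
    (res : H →+ P)
    (hloc : Finite ↥(W.selmerGroupPInfty p ⊓ selmerLocalKerPrimaryTorsion W ℚ_[p] p) →
      ∀ x : H, res x = 0 → ∃ n : ℕ, p ^ n • x = 0)
    (hBDV : W.entireLFunction 1 = 0 →
      (∀ m : ℕ, p ^ m • res (sp (Submodule.Quotient.mk κ)) ≠ 0) → W.analyticRank = 1)
    (hL : W.entireLFunction 1 = 0)
    (hfin : Finite ↥(W.selmerGroupPInfty p ⊓ selmerLocalKerPrimaryTorsion W ℚ_[p] p)) :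
    W.analyticRank = 1 :=
  -- Prop. 2.7: `z = sp (κ mod TS)` is not torsion; Prop. 2.8: nor is `res_p z`; Cor. 2.3
  hBDV hL (pow_smul_map_ne_zero_of_ker_torsion res
    (IwasawaAlgebra.pow_smul_specialization_ne_zero_of_finite_coinvariants p hκ hS hX hMC
      (hctl hfin) sp hsp) (hloc hfin))

/-- **Kim 2022, Cor. 1.2 from the skeleton** ((res) in its `p^∞`-form "`Sel_0(ℚ, E[p^∞])` finite",
as in `analyticRank_eq_one_of_selmerCorank_eq_one_of_kimCore`; all three printed conclusions).
Inputs: the skeleton data of `analyticRank_eq_one_of_skeleton`; Thm. 2.4 (Kato, tree fact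
`kato_finite_of_L_one_ne_zero W p`: "Although the `L(E, 1) = 0` assumption is incorporated in
Theorem 2.1, it can be removed in our main result thanks to the following theorem" — if
`L(E, 1) ≠ 0` then `Sel_{p^∞}(E/ℚ)` is finite, of corank `0`, contradicting (cork1)); and
Gross–Zagier–Kolyvagin (tree fact `rank_eq_analyticRank_of_analyticRank_le_one`) for "In
particular, `rk_ℤ E(ℚ) = 1` and `#Ш(E/ℚ) < ∞`".
[cite: Kim2022, Cor. 1.2, Thm. 1.1 and §2 (Thm. 2.4, concluding paragraph)] -/
theorem analyticRank_eq_one_of_selmerCorank_eq_one_of_skeleton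
    {S : Type u} [AddCommGroup S] [Module (IwasawaAlgebra p) S]
    [Module.Finite (IwasawaAlgebra p) S] [NoZeroSMulDivisors (IwasawaAlgebra p) S]
    {X : Type v} [AddCommGroup X] [Module (IwasawaAlgebra p) X]
    [Module.Finite (IwasawaAlgebra p) X]
    {H : Type w} [AddCommGroup H] {P : Type*} [AddCommGroup P]
    {κ : S} (hκ : κ ≠ 0)
    (hS : Module.IsTorsion (IwasawaAlgebra p) (S ⧸ Submodule.span (IwasawaAlgebra p) {κ}))
    (hX : Module.IsTorsion (IwasawaAlgebra p) X)
    (hMC : ∃ n : ℕ, Ideal.span {(p : IwasawaAlgebra p) ^ n} * Module.charIdeal (IwasawaAlgebra p) X ≤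
      Module.charIdeal (IwasawaAlgebra p) (S ⧸ Submodule.span (IwasawaAlgebra p) {κ}))
    (hctl : Finite ↥(W.selmerGroupPInfty p ⊓ selmerLocalKerPrimaryTorsion W ℚ_[p] p) →
      Finite (IwasawaAlgebra.coinvariants p X))
    (sp : IwasawaAlgebra.coinvariants p S →+ H) (hsp : ∀ x, sp x = 0 → ∃ n : ℕ, p ^ n • x = 0)
    (res : H →+ P)
    (hloc : Finite ↥(W.selmerGroupPInfty p ⊓ selmerLocalKerPrimaryTorsion W ℚ_[p] p) →
      ∀ x : H, res x = 0 → ∃ n : ℕ, p ^ n • x = 0)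
    (hBDV : W.entireLFunction 1 = 0 →
      (∀ m : ℕ, p ^ m • res (sp (Submodule.Quotient.mk κ)) ≠ 0) → W.analyticRank = 1)
    (hKato : kato_finite_of_L_one_ne_zero W p)
    (hGZK : rank_eq_analyticRank_of_analyticRank_le_one)
    (hcork : W.selmerCorank p = 1)
    (hres : Finite ↥(W.selmerGroupPInfty p ⊓ selmerLocalKerPrimaryTorsion W ℚ_[p] p)) :
    W.analyticRank = 1 ∧ W.mordellWeilRank = 1 ∧ Finite W.sha := by
  -- Thm. 2.4 (Kato): `L(E, 1) = 0`, for otherwise `Sel_{p^∞}(E/ℚ)` is finite, of corank `0 ≠ 1`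
  have hL : W.entireLFunction 1 = 0 := by
    by_contra hL
    obtain ⟨-, -, hfin⟩ := hKato hL
    haveI := hfin
    have h0 : W.selmerCorank p = 0 := W.selmerCorank_eq_zero_of_finite p
    omega
  -- Thm. 1.1 from the skeleton
  have han : W.analyticRank = 1 :=
    analyticRank_eq_one_of_skeleton W p hκ hS hX hMC hctl sp hsp res hloc hBDV hL hres
  -- "In particular": Gross–Zagier–Kolyvagin
  obtain ⟨hrk, hsha⟩ := hGZK W han.le
  exact ⟨han, hrk.trans han, hsha⟩

/-- **Kim 2022, Cor. 1.4 for one curve and one prime, from the skeleton and Gross–Zagier–Kolyvagin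
alone.** "Since Assumption (res) holds if we further assume `#Ш(E/ℚ)[p^∞] < ∞` in Corollary 1.2,
we obtain the following statement. Corollary 1.4. Let `E` be a non-CM elliptic curve over `ℚ`. If
`rk_ℤ E(ℚ) = 1` and `#Ш(E/ℚ)[p^∞] < ∞` for at least one good ordinary prime `p > 3` such that
`E[p]` is irreducible, then `ord_{s=1} L(E, s) = 1`. In particular, `#Ш(E/ℚ) < ∞`." From the
skeleton data of `analyticRank_eq_one_of_skeleton` at `(E, p)` and bsd.S17: (cork1)
`corank Sel_{p^∞}(E/ℚ) = rk + corank Ш[p^∞] = 1 + 0` (tree theorems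
`WeierstrassCurve.selmerCorank_eq_mordellWeilRank_add_holds`, `zpCorank_eq_zero_of_finite`);
`Sel_0(ℚ, E[p^∞])` finite by the rank-one strict-Selmer lemma (tree theorem
`finite_strictSelmer_of_mordellWeilRank_eq_one`; the source's Prop. 2.10 with (res)); Thm. 2.4
from Gross–Zagier–Kolyvagin (tree theorem `kato_finite_of_L_one_ne_zero_of_rank_eq_analyticRank`);
then Cor. 1.2 (`analyticRank_eq_one_of_selmerCorank_eq_one_of_skeleton`). The printed hypotheses
"non-CM, `p > 3` good ordinary, `E[p]` irreducible" enter only through the inputs (IMC), (K)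
(Remark 2.6), so they are not arguments here; see
`kim_analyticRank_eq_one_of_mordellWeilRank_eq_one_of_skeleton` for the quantified statement.
[cite: Kim2022, Cor. 1.4 (deduction from Cor. 1.2, §1) and §2] -/
theorem analyticRank_eq_one_of_mordellWeilRank_eq_one_of_skeleton [W.IsGloballyMinimal]
    {S : Type u} [AddCommGroup S] [Module (IwasawaAlgebra p) S]
    [Module.Finite (IwasawaAlgebra p) S] [NoZeroSMulDivisors (IwasawaAlgebra p) S]
    {X : Type v} [AddCommGroup X] [Module (IwasawaAlgebra p) X]
    [Module.Finite (IwasawaAlgebra p) X]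
    {H : Type w} [AddCommGroup H] {P : Type*} [AddCommGroup P]
    {κ : S} (hκ : κ ≠ 0)
    (hS : Module.IsTorsion (IwasawaAlgebra p) (S ⧸ Submodule.span (IwasawaAlgebra p) {κ}))
    (hX : Module.IsTorsion (IwasawaAlgebra p) X)
    (hMC : ∃ n : ℕ, Ideal.span {(p : IwasawaAlgebra p) ^ n} * Module.charIdeal (IwasawaAlgebra p) X ≤
      Module.charIdeal (IwasawaAlgebra p) (S ⧸ Submodule.span (IwasawaAlgebra p) {κ}))
    (hctl : Finite ↥(W.selmerGroupPInfty p ⊓ selmerLocalKerPrimaryTorsion W ℚ_[p] p) →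
      Finite (IwasawaAlgebra.coinvariants p X))
    (sp : IwasawaAlgebra.coinvariants p S →+ H) (hsp : ∀ x, sp x = 0 → ∃ n : ℕ, p ^ n • x = 0)
    (res : H →+ P)
    (hloc : Finite ↥(W.selmerGroupPInfty p ⊓ selmerLocalKerPrimaryTorsion W ℚ_[p] p) →
      ∀ x : H, res x = 0 → ∃ n : ℕ, p ^ n • x = 0)
    (hBDV : W.entireLFunction 1 = 0 →
      (∀ m : ℕ, p ^ m • res (sp (Submodule.Quotient.mk κ)) ≠ 0) → W.analyticRank = 1)
    (hGZK : rank_eq_analyticRank_of_analyticRank_le_one)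
    (hrank : W.mordellWeilRank = 1) (hsha : Finite ↥(AddCommGroup.primaryComponent W.sha p)) :
    W.analyticRank = 1 ∧ Finite W.sha := by
  haveI := hsha
  -- (cork1): `corank Sel_{p^∞} = rk + corank Ш[p^∞] = 1 + 0`
  have h0 : W.shaCorank p = 0 := zpCorank_eq_zero_of_finite _ p
  have hcork : W.selmerCorank p = 1 := by
    rw [W.selmerCorank_eq_mordellWeilRank_add_holds p, hrank, h0]
  -- (res) in `p^∞`-form: the rank-one strict-Selmer lemma
  have hres : Finite ↥(W.selmerGroupPInfty p ⊓ selmerLocalKerPrimaryTorsion W ℚ_[p] p) :=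
    finite_strictSelmer_of_mordellWeilRank_eq_one W p hrank
  -- Cor. 1.2, with Thm. 2.4 supplied from Gross–Zagier–Kolyvagin
  obtain ⟨han, -, hfin⟩ := analyticRank_eq_one_of_selmerCorank_eq_one_of_skeleton W p hκ hS hX
    hMC hctl sp hsp res hloc hBDV (kato_finite_of_L_one_ne_zero_of_rank_eq_analyticRank W p hGZK)
    hGZK hcork hres
  exact ⟨han, hfin⟩

end Kim2022

/-! ### The named fact from skeleton data for every `(E, p)` and Gross–Zagier–Kolyvagin -/

/-- **bsd.S25 `kim_analyticRank_eq_one_of_mordellWeilRank_eq_one` (Kim 2022, Cor. 1.4) from the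
`Λ`-module skeleton of §2 and Gross–Zagier–Kolyvagin.** Hypothesis `hdata`: for every non-CM
`E/ℚ` (globally minimal model `W`) and every good ordinary prime `p > 3` with `E[p]` irreducible —
exactly the printed hypotheses of Cor. 1.2/1.4, under which Remark 2.6 supplies (IMC) and Kato's
theorems supply (K) — there exist skeleton data `(S, κ, X, H, P, sp, res)` as in
`Kim2022.analyticRank_eq_one_of_skeleton` satisfying (K), (IMC), (CTL), (SP), (LOC), (BDV):
Kato's `H¹_Iw(ℚ, T_pE) ∋ z_Kato^∞` and `Sel_0(ℚ_∞, E[p^∞])^∨` (Astérisque 295, Thm. 12.4, §13,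
Thm. 17.4), the main conjecture inverting `p` (Kato, Skinner–Urban, Wan), Kurihara's control
theorem, the specialisation `H¹_Iw(ℚ, T)_Γ ↪ H¹(ℚ, T)`, "`Sel_0(ℚ, E[p^∞])` finite
`⟹ Sel_0(ℚ, V) = 0`", and Bertolini–Darmon–Venerucci (Thm. 2.1/Cor. 2.3). Hypothesis `hGZK`:
bsd.S17. Conclusion: the named fact, through
`kim_analyticRank_eq_one_of_mordellWeilRank_eq_one_of_kimCore_of_gzk` (first sibling file), whose
`hcore` is `Kim2022.analyticRank_eq_one_of_skeleton` applied to the data. So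
`kim_analyticRank_eq_one_of_mordellWeilRank_eq_one_holds` is this theorem applied to a
construction of the data and to `rank_eq_analyticRank_of_analyticRank_le_one`; nothing is asserted
here. [cite: Kim2022, Cor. 1.4, Cor. 1.2, Thm. 1.1 and §2] -/
theorem kim_analyticRank_eq_one_of_mordellWeilRank_eq_one_of_skeleton
    (hdata : ∀ (W : WeierstrassCurve ℚ) [W.IsElliptic] [W.IsGloballyMinimal], ¬ W.HasCM →
      ∀ (p : ℕ) [Fact p.Prime], 3 < p → W.HasGoodReductionAtPrime p →
      ¬ (p : ℤ) ∣ W.frobeniusTrace p → W.HasIrreducibleModPGaloisRep p →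
      ∃ (S : Type) (_ : AddCommGroup S) (_ : Module (IwasawaAlgebra p) S)
        (_ : Module.Finite (IwasawaAlgebra p) S) (_ : NoZeroSMulDivisors (IwasawaAlgebra p) S)
        (X : Type) (_ : AddCommGroup X) (_ : Module (IwasawaAlgebra p) X)
        (_ : Module.Finite (IwasawaAlgebra p) X)
        (H : Type) (_ : AddCommGroup H) (P : Type) (_ : AddCommGroup P)
        (κ : S) (sp : IwasawaAlgebra.coinvariants p S →+ H) (res : H →+ P),
        κ ≠ 0 ∧ Module.IsTorsion (IwasawaAlgebra p) (S ⧸ Submodule.span (IwasawaAlgebra p) {κ}) ∧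
        Module.IsTorsion (IwasawaAlgebra p) X ∧
        (∃ n : ℕ, Ideal.span {(p : IwasawaAlgebra p) ^ n} * Module.charIdeal (IwasawaAlgebra p) X ≤
          Module.charIdeal (IwasawaAlgebra p) (S ⧸ Submodule.span (IwasawaAlgebra p) {κ})) ∧
        (Finite ↥(W.selmerGroupPInfty p ⊓ selmerLocalKerPrimaryTorsion W ℚ_[p] p) →
          Finite (IwasawaAlgebra.coinvariants p X)) ∧
        (∀ x, sp x = 0 → ∃ n : ℕ, p ^ n • x = 0) ∧
        (Finite ↥(W.selmerGroupPInfty p ⊓ selmerLocalKerPrimaryTorsion W ℚ_[p] p) →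
          ∀ x : H, res x = 0 → ∃ n : ℕ, p ^ n • x = 0) ∧
        (W.entireLFunction 1 = 0 →
          (∀ m : ℕ, p ^ m • res (sp (Submodule.Quotient.mk κ)) ≠ 0) → W.analyticRank = 1))
    (hGZK : rank_eq_analyticRank_of_analyticRank_le_one) :
    kim_analyticRank_eq_one_of_mordellWeilRank_eq_one := by
  refine kim_analyticRank_eq_one_of_mordellWeilRank_eq_one_of_kimCore_of_gzk ?_ hGZK
  intro W _ _ hcm p _ hp hgood hord hirr hL _ hfin
  obtain ⟨S, _, _, _, _, X, _, _, _, H, _, P, _, κ, sp, res, hκ, hS, hX, hMC, hctl, hsp, hloc,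
    hBDV⟩ := hdata W hcm p hp hgood hord hirr
  exact Kim2022.analyticRank_eq_one_of_skeleton W p hκ hS hX hMC hctl sp hsp res hloc hBDV hL hfin

end Literature.NumberTheory.EllipticCurves

end
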